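import Literature.Algebra.Homology.LaurentCechGradedSubquotient
import Literature.Algebra.Homology.LaurentCechGradedQuotientFunctoriality
import HarnessLib

/-!
# Subquotients are quotients: `Č_d(N' ⧸ N) ≅ Č_d(F_{e'} ⧸ φ⁻¹N)` for a presentation `φ : F_{e'} ↠ N'`

In the tree's Čech language for coherent sheaves on `ℙ^r_A` (`Literature.Algebra.Homology.LaurentCech*`)
a coherent sheaf appears in two guises:

* as a graded QUOTIENT `M = F_e ⧸ K` of a split bundle `F_e = ⊕_j P(-e j)` — complex
  `LaurentCech.quot e K d = coker(Č_d(K) ↪ Č_d(F_e))` (`LaurentCechGradedQuotient`), the form in which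
  the cohomological theorems of the tree are stated (Serre finiteness and vanishing, Grothendieck
  vanishing, cohomological Hilbert polynomials, Castelnuovo–Mumford regularity, …);
* as a graded SUBQUOTIENT `N' ⧸ N` (`N ≤ N' ≤ F_e`) — complex
  `LaurentCech.subquot e N N' h d = coker(Č_d(N) ↪ Č_d(N'))` (`LaurentCechGradedSubquotient`), the form
  in which ideal sheaves `𝓘_{Z ⊂ X} = (N' ⧸ N)~` of closed subschemes `Z = (F_e ⧸ N')~` of
  `X = (F_e ⧸ N)~` arise (`LaurentCechIdealSheafSequence`, Mumford's Lectures 14–15 files).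

This file identifies the two: choosing a degree-zero presentation `φ : F_{e'} → F_e` of the graded
submodule `N' = im φ` (`LaurentCechExact.exists_presentation`), the graded module `N' ⧸ N` is the
quotient `F_{e'} ⧸ φ⁻¹(N)` of the free graded module `F_{e'}`, and the Čech complexes agree:

* `LaurentCech.IsDegZero.isGraded_comap` — `φ⁻¹(N)` is graded when `N` is;
* `LaurentCech.exists_extL_add_of_sup_eq` — if `N' = φ(F_{e'}) + N` (`N` graded) then every element of
  `((N')_{x_s})_d` is `φ_L x + k` with `x ∈ ((F_{e'})_{x_s})_d`, `k ∈ (N_{x_s})_d`;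
* `LaurentCech.injective_cokernel_map_inclusion_f` / `LaurentCech.surjective_cokernel_map_inclusion_f` /
  **`LaurentCech.isIso_cokernel_map_inclusion`** — the map
  `Č_d(F_{e'} ⧸ K') ⟶ Č_d(N' ⧸ N)` induced (`cokernel.map` of the square of `cechMapOf`s) by a
  degree-zero `φ` with `φ(K') ⊆ N`, `φ(F_{e'}) ⊆ N'` is injective when `φ⁻¹(N) ⊆ K'`, surjective when
  `φ(F_{e'}) + N = N'`, hence an isomorphism of cochain complexes when `φ` induces
  `F_{e'} ⧸ K' ≅ N' ⧸ N` — the subquotient version of the presentation independence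
  `LaurentCechGradedQuotientFunctoriality.isIso_quotMapOf`;
* **`LaurentCech.nonempty_iso_quot_comap_subquot`** — `Č_d(F_{e'} ⧸ φ⁻¹N) ≅ Č_d(N' ⧸ N)` for
  `N ≤ N' = im φ`, `N` graded; **`LaurentCech.exists_quot_iso_subquot`** — for graded `N ≤ N'` over a
  Noetherian ring there is a graded `K' ⊆ F_{e'}` (`e' : Fin n → ℤ`) with
  `Č_d(F_{e'} ⧸ K') ≅ Č_d(N' ⧸ N)` for EVERY twist `d` (one presentation serves all twists);
* `LaurentCech.finrank_homology_quot_comap_eq`, `LaurentCech.isZero_homology_quot_comap_iff`,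
  `LaurentCech.exists_quot_finrank_homology_eq_subquot` — the cohomology modules agree (ranks,
  vanishing), so every theorem of the tree about `H^i(Č_d(F_e ⧸ K))` for graded `K` transfers to
  `H^i(Č_d(N' ⧸ N))`, i.e. to ideal sheaves and to arbitrary subquotient presentations.

This is the standard remark that `M ↦ M~` is an exact functor from graded `S`-modules to
quasi-coherent sheaves commuting with twists, so that `(N'/N)~(d)` has Čech complex computed from any
presentation of `N'/N` [Hartshorne, II Prop. 5.11–5.12 and Ex. 5.9, III Thm. 5.1 (proof)];
[Görtz–Wedhorn I, (13.1); II, Lemma 23.10].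

## References

* [Hartshorne1977] R. Hartshorne, *Algebraic Geometry*, GTM 52, Springer 1977, II §5
  (Prop. 5.11, Cor. 5.18, p. 116–121), III Thm. 5.1 (proof, p. 225).
* [GortzWedhorn2020] U. Görtz, T. Wedhorn, *Algebraic Geometry I: Schemes*, 2nd ed., Springer 2020,
  (13.1) (PDF p. 466): the functor `M ↦ M~` on `Proj`.
* [GortzWedhorn2023] U. Görtz, T. Wedhorn, *Algebraic Geometry II: Cohomology of Schemes*, Springer
  2023, Lemma 23.10 (p. 420).
-/

noncomputable section

open CategoryTheory CategoryTheory.Limits Pointwise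

universe u

namespace Literature.Algebra.Homology

namespace LaurentCech

open OrderedCech TopCohomology

variable {A : Type u} [CommRing A] {r : ℕ} {J J' : Type} {e : J → ℤ} {e' : J' → ℤ}
  {φ : (J' → P A r) →ₗ[P A r] (J → P A r)}

/-! ### Preimages of graded submodules under degree-zero maps -/

/-- **`φ⁻¹(N)` is a graded submodule of `F_{e'}`** for `φ : F_{e'} → F_e` of degree zero and
`N ⊆ F_e` graded (`φ` commutes with taking homogeneous components).
[cite: Hartshorne1977, III Thm. 5.1 (proof, p. 225)] -/
theorem IsDegZero.isGraded_comap (hφ : IsDegZero e e' φ) {N : Submodule (P A r) (J → P A r)}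
    (hN : IsGraded e N) : IsGraded e' (N.comap φ) := by
  intro dd w hw
  rw [Submodule.mem_comap] at hw ⊢
  rw [hφ]
  exact hN dd _ hw

variable [Fintype J'] [DecidableEq J']

/-! ### Surjectivity on the localized graded pieces -/

/-- **If `N' = φ(F_{e'}) + N` with `N` graded and `φ` of degree zero, every `y ∈ ((N')_{x_s})_d` is
`φ_L x + k` with `x ∈ ((F_{e'})_{x_s})_d`, `k ∈ (N_{x_s})_d`** (clear denominators, decompose in
`N' = im φ + N`, and project onto the relevant degree) — the subquotient version of
`LaurentCechGradedQuotientFunctoriality.exists_extL_add_of_sup_eq_top`.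
[cite: GortzWedhorn2020, (13.1) (PDF p. 466)] [cite: Hartshorne1977, III Thm. 5.1 (proof, p. 225)] -/
theorem exists_extL_add_of_sup_eq (hφ : IsDegZero e e' φ) {N N' : Submodule (P A r) (J → P A r)}
    (hNg : IsGraded e N) (hsurj : LinearMap.range φ ⊔ N = N') {s : Finset (Fin (r + 1))} {d : ℤ}
    {y : J → L A r} (hy : y ∈ locDeg e N' s d) :
    ∃ x ∈ locDeg e' (⊤ : Submodule (P A r) (J' → P A r)) s d, ∃ k ∈ locDeg e N s d,
      y = extL φ x + k := by
  obtain ⟨⟨M, v, hvN', hMv⟩, hydeg⟩ := (mem_locDeg _ _).1 hy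
  have hv : v ∈ LinearMap.range φ ⊔ N := by rw [hsurj]; exact hvN'
  obtain ⟨_, ⟨u, rfl⟩, k₀, hk₀, huk⟩ := Submodule.mem_sup.1 hv
  set D : ℤ := d + M * s.card with hD
  have hv' : xs A s M • y ∈ Kdeg A r e D := xs_smul_mem_Kdeg e hydeg s M
  have hsum : extL φ (ιK A r J' (projDeg e' D u)) + ιK A r J (projDeg e D k₀) = xs A s M • y := by
    rw [extL_ιK, hφ, ← map_add, ← map_add, huk, ιK_projDeg, ← hMv, KfilterDeg_of_mem e hv']
  refine ⟨xs A s (-(M : ℤ)) • ιK A r J' (projDeg e' D u), (mem_locDeg _ _).2 ⟨?_, ?_⟩,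
    xs A s (-(M : ℤ)) • ιK A r J (projDeg e D k₀), (mem_locDeg _ _).2 ⟨?_, ?_⟩, ?_⟩
  · exact xs_smul_mem_loc ⊤ (ιK_mem_loc ⊤ Submodule.mem_top) _
  · have := xs_smul_mem_Kdeg e' (ιK_projDeg_mem_Kdeg e' D u) s (-(M : ℤ))
    rwa [hD, show d + (M : ℤ) * s.card + -(M : ℤ) * s.card = d by ring] at this
  · exact xs_smul_mem_loc N (ιK_mem_loc N (hNg D k₀ hk₀)) _
  · have := xs_smul_mem_Kdeg e (ιK_projDeg_mem_Kdeg e D k₀) s (-(M : ℤ))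
    rwa [hD, show d + (M : ℤ) * s.card + -(M : ℤ) * s.card = d by ring] at this
  · rw [extL_smul, ← smul_add, hsum, smul_smul, xs_neg_mul_xs, one_smul]

/-! ### The comparison map `Č_d(F_{e'} ⧸ K') ⟶ Č_d(N' ⧸ N)` -/

/-- **Injectivity**: the map `Č_d(F_{e'} ⧸ K') ⟶ Č_d(N' ⧸ N)` induced by a degree-zero
`φ : F_{e'} → F_e` with `φ(K') ⊆ N`, `φ(F_{e'}) ⊆ N'` (`cokernel.map` of the commutative square of
`cechMapOf`s over the inclusions `Č(K') ↪ Č(F_{e'})`, `Č(N) ↪ Č(N')`) is injective in every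
cochain degree as soon as `φ⁻¹(N) ⊆ K'`.
[cite: GortzWedhorn2020, (13.1) (PDF p. 466)] [cite: Hartshorne1977, III Thm. 5.1 (proof, p. 225)] -/
theorem injective_cokernel_map_inclusion_f (hφ : IsDegZero e e' φ)
    (K' : Submodule (P A r) (J' → P A r)) {N N' : Submodule (P A r) (J → P A r)} (h : N ≤ N')
    (hK : K'.map φ ≤ N) (hN' : (⊤ : Submodule (P A r) (J' → P A r)).map φ ≤ N')
    (hinj : ∀ u, φ u ∈ N → u ∈ K') (d i : ℤ) :
    Function.Injective ((cokernel.map (inclusion e' K' ⊤ le_top d) (inclusion e N N' h d)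
      (cechMapOf hφ K' N hK d) (cechMapOf hφ ⊤ N' hN' d)
      (inclusion_comp_cechMapOf hφ K' ⊤ le_top N N' h hK hN' d)).f i).hom := by
  refine injective_cokernel_map_f _ _ _ _ _ i fun x hx => ?_
  rw [mem_range_inclusion_f_iff] at hx ⊢
  intro σ
  have h1 := hx σ
  rw [cechMapOf_f_apply_coe] at h1
  exact mem_loc_of_extL_mem_loc hinj ((mem_locDeg _ _).1
    ((x : Cochain (fun s => locDeg e' (⊤ : Submodule (P A r) (J' → P A r)) s d) i) σ).2).1 h1

/-- **Surjectivity**: the same map is surjective in every cochain degree as soon as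
`φ(F_{e'}) + N = N'` (`N` graded). [cite: GortzWedhorn2020, (13.1) (PDF p. 466)]
[cite: Hartshorne1977, III Thm. 5.1 (proof, p. 225)] -/
theorem surjective_cokernel_map_inclusion_f (hφ : IsDegZero e e' φ)
    (K' : Submodule (P A r) (J' → P A r)) {N N' : Submodule (P A r) (J → P A r)} (h : N ≤ N')
    (hNg : IsGraded e N) (hK : K'.map φ ≤ N) (hN' : (⊤ : Submodule (P A r) (J' → P A r)).map φ ≤ N')
    (hsurj : LinearMap.range φ ⊔ N = N') (d i : ℤ) :
    Function.Surjective ((cokernel.map (inclusion e' K' ⊤ le_top d) (inclusion e N N' h d)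
      (cechMapOf hφ K' N hK d) (cechMapOf hφ ⊤ N' hN' d)
      (inclusion_comp_cechMapOf hφ K' ⊤ le_top N N' h hK hN' d)).f i).hom := by
  intro z
  obtain ⟨y, rfl⟩ := surjective_cokernel_π_f (inclusion e N N' h d) i z
  have hdec : ∀ σ : Simplex (Fin (r + 1)) i,
      ∃ x ∈ locDeg e' (⊤ : Submodule (P A r) (J' → P A r)) σ.1 d, ∃ k ∈ locDeg e N σ.1 d,
        ((y : Cochain (fun s => locDeg e N' s d) i) σ : J → L A r) = extL φ x + k := fun σ =>
    exists_extL_add_of_sup_eq hφ hNg hsurj ((y : Cochain (fun s => locDeg e N' s d) i) σ).2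
  choose x hx k hk hyxk using hdec
  let xc : (cech e' (⊤ : Submodule (P A r) (J' → P A r)) d).X i :=
    (fun σ => ⟨x σ, hx σ⟩ : Cochain (fun s => locDeg e' (⊤ : Submodule (P A r) (J' → P A r)) s d) i)
  let kc : (cech e N d).X i := (fun σ => ⟨k σ, hk σ⟩ : Cochain (fun s => locDeg e N s d) i)
  have hy : y = ((cechMapOf hφ ⊤ N' hN' d).f i).hom xc + ((inclusion e N N' h d).f i).hom kc := by
    funext σ
    apply Subtype.ext
    exact hyxk σ
  refine ⟨((cokernel.π (inclusion e' K' ⊤ le_top d)).f i).hom xc, ?_⟩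
  rw [cokernel_π_f_comp_map_f, hy, map_add, cokernel_π_f_apply_f, add_zero]

/-- **Presentation independence, subquotient form**: if the degree-zero `φ : F_{e'} → F_e` induces an
isomorphism of graded modules `F_{e'} ⧸ K' ≅ N' ⧸ N` (`φ(K') ⊆ N`, `φ(F_{e'}) ⊆ N'`, `φ⁻¹(N) ⊆ K'`,
`φ(F_{e'}) + N = N'`; `N` graded), the induced `Č_d(F_{e'} ⧸ K') ⟶ Č_d(N' ⧸ N)` is an isomorphism of
cochain complexes, for every twist `d`.
[cite: Hartshorne1977, III Thm. 5.1 (proof, p. 225)] [cite: GortzWedhorn2020, (13.1) (PDF p. 466)] -/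
theorem isIso_cokernel_map_inclusion (hφ : IsDegZero e e' φ) (K' : Submodule (P A r) (J' → P A r))
    {N N' : Submodule (P A r) (J → P A r)} (h : N ≤ N') (hNg : IsGraded e N) (hK : K'.map φ ≤ N)
    (hN' : (⊤ : Submodule (P A r) (J' → P A r)).map φ ≤ N') (hinj : ∀ u, φ u ∈ N → u ∈ K')
    (hsurj : LinearMap.range φ ⊔ N = N') (d : ℤ) :
    IsIso (cokernel.map (inclusion e' K' ⊤ le_top d) (inclusion e N N' h d)
      (cechMapOf hφ K' N hK d) (cechMapOf hφ ⊤ N' hN' d)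
      (inclusion_comp_cechMapOf hφ K' ⊤ le_top N N' h hK hN' d)) := by
  haveI : ∀ i, IsIso ((cokernel.map (inclusion e' K' ⊤ le_top d) (inclusion e N N' h d)
      (cechMapOf hφ K' N hK d) (cechMapOf hφ ⊤ N' hN' d)
      (inclusion_comp_cechMapOf hφ K' ⊤ le_top N N' h hK hN' d)).f i) := fun i =>
    (ConcreteCategory.isIso_iff_bijective _).2
      ⟨injective_cokernel_map_inclusion_f hφ K' h hK hN' hinj d i,
        surjective_cokernel_map_inclusion_f hφ K' h hNg hK hN' hsurj d i⟩
  exact HomologicalComplex.Hom.isIso_of_components _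

/-! ### Subquotients are quotients -/

/-- **`Č_d(F_{e'} ⧸ φ⁻¹N) ≅ Č_d(N' ⧸ N)`** for a degree-zero presentation `φ : F_{e'} ↠ N' = im φ` of
`N'` and a graded `N ≤ N'`: the Čech complex of the subquotient `N' ⧸ N` (e.g. of an ideal sheaf
`𝓘_{Z ⊂ X}(d) = (N' ⧸ N)~(d)`) is the Čech complex of the graded quotient `F_{e'} ⧸ φ⁻¹(N)` of a free
graded module. [cite: Hartshorne1977, III Thm. 5.1 (proof, p. 225)]
[cite: GortzWedhorn2023, Lemma 23.10 (p. 420)] -/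
theorem nonempty_iso_quot_comap_subquot (hφ : IsDegZero e e' φ)
    {N N' : Submodule (P A r) (J → P A r)} (hNg : IsGraded e N) (h : N ≤ N')
    (hφN' : LinearMap.range φ = N') (d : ℤ) :
    Nonempty (quot e' (N.comap φ) d ≅ subquot e N N' h d) := by
  have hK : (N.comap φ).map φ ≤ N := Submodule.map_comap_le φ N
  have hN' : (⊤ : Submodule (P A r) (J' → P A r)).map φ ≤ N' := by
    rw [Submodule.map_top, hφN']
  have hsurj : LinearMap.range φ ⊔ N = N' := by rw [hφN']; exact sup_eq_left.2 h
  haveI := isIso_cokernel_map_inclusion hφ (N.comap φ) h hNg hK hN' (fun u hu => hu) hsurj d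
  exact ⟨asIso (cokernel.map (inclusion e' (N.comap φ) ⊤ le_top d) (inclusion e N N' h d)
    (cechMapOf hφ (N.comap φ) N hK d) (cechMapOf hφ ⊤ N' hN' d)
    (inclusion_comp_cechMapOf hφ (N.comap φ) ⊤ le_top N N' h hK hN' d))⟩

/-- Hence `H^i(Č_d(F_{e'} ⧸ φ⁻¹N))` and `H^i(Č_d(N' ⧸ N))` have the same rank …
[cite: Hartshorne1977, III Thm. 5.1 (proof, p. 225)] -/
theorem finrank_homology_quot_comap_eq (hφ : IsDegZero e e' φ)
    {N N' : Submodule (P A r) (J → P A r)} (hNg : IsGraded e N) (h : N ≤ N')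
    (hφN' : LinearMap.range φ = N') (d i : ℤ) :
    Module.finrank A ((quot e' (N.comap φ) d).homology i) =
      Module.finrank A ((subquot e N N' h d).homology i) := by
  obtain ⟨I⟩ := nonempty_iso_quot_comap_subquot hφ hNg h hφN' d
  exact ((HomologicalComplex.homologyFunctor (ModuleCat.{u} A) (ComplexShape.up ℤ) i).mapIso
    I).toLinearEquiv.finrank_eq

/-- … and vanish together. [cite: Hartshorne1977, III Thm. 5.1 (proof, p. 225)] -/
theorem isZero_homology_quot_comap_iff (hφ : IsDegZero e e' φ)
    {N N' : Submodule (P A r) (J → P A r)} (hNg : IsGraded e N) (h : N ≤ N')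
    (hφN' : LinearMap.range φ = N') (d i : ℤ) :
    IsZero ((quot e' (N.comap φ) d).homology i) ↔ IsZero ((subquot e N N' h d).homology i) := by
  obtain ⟨I⟩ := nonempty_iso_quot_comap_subquot hφ hNg h hφN' d
  let I' := (HomologicalComplex.homologyFunctor (ModuleCat.{u} A) (ComplexShape.up ℤ) i).mapIso I
  exact ⟨fun hz => hz.of_iso I'.symm, fun hz => hz.of_iso I'⟩

/-- **Every graded subquotient `N' ⧸ N ⊆ F_e ⧸ N` is a graded quotient of a free graded module, with
the same Čech complexes in all twists**: for graded `N ≤ N' ⊆ F_e` over a Noetherian ring there are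
`e' : Fin n → ℤ` and a graded `K' ⊆ F_{e'}` with `Č_d(F_{e'} ⧸ K') ≅ Č_d(N' ⧸ N)` for every `d`
(present `N'` by finitely many homogeneous generators, `LaurentCechExact.exists_presentation`, and take
`K' = φ⁻¹ N`). [cite: Hartshorne1977, II Cor. 5.18 (p. 121)]
[cite: Hartshorne1977, III Thm. 5.1 (proof, p. 225)] -/
theorem exists_quot_iso_subquot [Finite J] [IsNoetherianRing A] {N N' : Submodule (P A r) (J → P A r)}
    (hNg : IsGraded e N) (hN'g : IsGraded e N') (h : N ≤ N') :
    ∃ (n : ℕ) (e' : Fin n → ℤ) (K' : Submodule (P A r) (Fin n → P A r)),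
      IsGraded e' K' ∧ ∀ d : ℤ, Nonempty (quot e' K' d ≅ subquot e N N' h d) := by
  obtain ⟨n, e', φ, hφ, hφN'⟩ := exists_presentation e hN'g
  exact ⟨n, e', N.comap φ, hφ.isGraded_comap hNg, fun d =>
    nonempty_iso_quot_comap_subquot hφ hNg h hφN' d⟩

/-- Numerical form of `exists_quot_iso_subquot`: a graded quotient `F_{e'} ⧸ K'` of a free graded
module with `rk H^i(Č_d(F_{e'} ⧸ K')) = rk H^i(Č_d(N' ⧸ N))` and
`H^i(Č_d(F_{e'} ⧸ K')) = 0 ↔ H^i(Č_d(N' ⧸ N)) = 0` for all `d`, `i`.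
[cite: Hartshorne1977, III Thm. 5.1 (proof, p. 225)] -/
theorem exists_quot_finrank_homology_eq_subquot [Finite J] [IsNoetherianRing A]
    {N N' : Submodule (P A r) (J → P A r)} (hNg : IsGraded e N) (hN'g : IsGraded e N') (h : N ≤ N') :
    ∃ (n : ℕ) (e' : Fin n → ℤ) (K' : Submodule (P A r) (Fin n → P A r)), IsGraded e' K' ∧
      (∀ d i : ℤ, Module.finrank A ((quot e' K' d).homology i) =
        Module.finrank A ((subquot e N N' h d).homology i)) ∧
      ∀ d i : ℤ, IsZero ((quot e' K' d).homology i) ↔ IsZero ((subquot e N N' h d).homology i) := by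
  obtain ⟨n, e', φ, hφ, hφN'⟩ := exists_presentation e hN'g
  exact ⟨n, e', N.comap φ, hφ.isGraded_comap hNg,
    fun d i => finrank_homology_quot_comap_eq hφ hNg h hφN' d i,
    fun d i => isZero_homology_quot_comap_iff hφ hNg h hφN' d i⟩

end LaurentCech

end Literature.Algebra.Homology

end
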